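import Literature.MathematicalPhysics.QuantumFieldTheory.King1986.CovarianceRate
import HarnessLib

/-!
# King 1986, proof of Prop. 3.9, (4.42)–(4.43): the η-rate of a SINGLE-SCALE PIECE from the rates of its
# three factors — factor-by-factor replacement + the triple exponential convolution

**Citation header (reproduction of a PUBLISHED and PROVED `A = 0` bookkeeping step; literature seat
`b2b-balaban-t4-lit2` gen 6 of the Bałaban lattice Yang–Mills cell `pub-balaban`; record `t4/T4-LIT2-CITABLE-NE.md`
v2.9 §8.13 (i)/(ii); CITED-FACTS S-t4lit2g6-1; companion of `King1986/CovarianceRate` (Lemma 4.5, whose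
`triple_decay_bound` is the convolution engine reused here) and of `King1986/AveragingWeightRate` (whose header lists
«Proposition 3.9 ((4.42)–(4.43))» as NOT COVERED — this file covers exactly that assembly, abstractly).  v1.0.1: DOCSTRING-ONLY
fold of the cross-read (pv11-g15, GAPS C-pv11g15-6: ok CONSISTENT, DOCFIX owed 0, two optional LOW wording items D-1/D-2);
every declaration byte-identical to v1 (p187942).**
C. King, *The U(1) Higgs model. I. The continuum limit*, Commun. Math. Phys. **102** (1986) 649–677 [King1986],
§4 p. 675.  Page images read AS IMAGES by this seat: `b2b-balaban-template/king-renders/1986-cmp102-king-u1-higgs-I-p027-x2.png`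
(p. 675: (4.40)–(4.45)), `…-p026-x2.png` (p. 674: (4.32)–(4.39)), `…-p017-x2.png` (p. 665: Prop. 3.9 «(also proved in
Sect. 4)»), `…-p022-x2.png` (p. 670: «(and A = 0, of course)»), `…-p024-x2.png` (p. 672: Lemma 4.3, (4.19)).

**What King prints (verbatim, p. 675).**  «We are finally ready to prove Proposition 3.9. We will prove the first bound
in (3.73); the other bounds follow in the same way. For j > 0, we have the expansion
G^{η′}_{(j)}(x′, y′) = a²_{j+n}(L^jη)^{−4} Σ_{z,w∈L^jηZ^d} (L^jη)^{2d}G^{η′}_{j+n}Q*_{j+n}(x′, z) · C^{(j+n),L^jη}(z, w)Q_{j+n}G^{η′}_{j+n}(w, y′). (4.42)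
We now replace a_{j+n}Q_{j+n}G^{η′}_{j+n}(w, y′) by a_jQ_jG^η_j(w, y) in (4.42); using Proposition 3.8 and the scaling of
operators (2.20), the error from this replacement is bounded by
C(L^jη)^{−4} Σ_{z,w} (L^jη)^{2d}(L^jη)^{2−d} exp[−δ₀(L^jη)^{−1}|x′ − z|] (L^jη)^{2−d} · exp[−δ₀(L^jη)^{−1}|z − w|] ·
L^{−γj}(L^jη)^{2−d} exp[−δ₀(L^jη)^{−1}|w − y′|] ≤ C(L^jη)^{2−3d}L^{−γj} Σ_{z,w} (L^jη)^{2d} exp[−δ₀(L^jη)^{−1}{|x′ − z| +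
|z − w| + |w − y′|}] ≤ C(L^jη)^{2−d}L^{−γj} exp[−δ₀(L^jη)^{−1}|x′ − y′|] ≤ CL^{−γk}(L^jη)^{2−d−γ} exp[−δ₀(L^jη)^{−1}|x − y|]. (4.43)
Clearly we can replace a_{j+n}G^{η′}_{j+n}Q*_{j+n}(x′z) by a_jG^η_jQ*_j(x, z), and C^{(j+n),L^jη}(z, w) by C^{(j),L^jη}(z, w),
and bound the error in the same way. Hence we deduce the required bound. When j = 0, we bound each term separately using
Proposition 3.7, and write the factor η^{2−d} as L^{−γk}L^{−k(2−d−γ)}.»  (Inputs in print: Prop. 3.8 (3.71) p. 664 —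
the rate of the outer factors `a_kG_kQ_k^*`; Lemma 4.5 (4.38) p. 674 — the rate of the middle factor `C^{(k)}`; the
uniform decay of all factors, Thm 3.3 / (4.33)–(4.34).)  OBJECTS: King's `A = 0` single-scale pieces `G_(j)` of the
telescoping (2.17)/(3.60) — scalar block averaging, free/periodic parallelepipeds, `d = 2, 3` as printed («and A = 0, of
course», p. 670).  NOT Bałaban's Landau-gauge vector or background-dependent propagators: nothing below refers to them.

**What is proved here (everything PROVED; Mathlib + the tree's `King1986.triple_decay_bound`; NO named fact;
[folklore] algebra and finite sums).**  Over an arbitrary finite index set `n` (the sites of the scale-`L^jη` lattice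
in a box), with a pseudo-distance `d ≥ 0` obeying the triangle inequality (King's `(L^jη)^{−1}|x − y|`), and real
matrices:
* §1 `prod3_sub_prod3`: `A′C′B′ − ACB = (A′ − A)C′B′ + A(C′ − C)B′ + AC(B′ − B)` — the three «replace … and bound
  the error in the same way» steps as ONE identity.
* §2 **`prod3_rate`** (= (4.43) abstractly): if `a·e^{−κd}`-type size bounds hold for the FOUR kernels that occur
  as undifferenced factors in the telescoped identity (`A` with constant `a`, `C` and `C′` with `c`, `B′` with `b` — the
  sizes of `A′` and `B` are never needed), the three DIFFERENCES obey
  `|A′ − A| ≤ εA·e^{−κd}`, `|C′ − C| ≤ εC·e^{−κd}`, `|B′ − B| ≤ εB·e^{−κd}`, and `Σ_z e^{−(κ/2)d(x,z)} ≤ V` for every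
  `x` (a PURE NUMBER when `d` is measured in units of the scale, exactly King's «Σ_{z,w}(L^jη)^{2d}exp[…]» step), then
  `|(A′C′B′ − ACB)(x,y)| ≤ (εA·c·b + a·εC·b + a·c·εB)·V²·e^{−(κ/2)d(x,y)}`
  — three applications of `King1986.triple_decay_bound` ((4.41)'s engine).  King keeps `δ₀` in the final exponent under
  the generic-constant convention; the kernel version halves the rate and pays `V²` for the two lattice sums, as
  `CovarianceRate` does for (4.41).
* §3 `prod3_rate_rel`: the RELATIVE form King uses — factor rates `εA = θA·a`, `εC = θC·c`, `εB = θB·b` give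
  `(θA + θC + θB)·(a·c·b)·V²·e^{−(κ/2)d}`; and `scale_bookkeeping`: the prefactor arithmetic of (4.43),
  `s^{−4}·s^{2d}·(s^{2−d})³ = s^{2−d}` for `s = L^jη > 0` (so three factors of size `s^{2−d}`, the `(L^jη)^{−4}` of
  (4.42) and the `(L^jη)^{2d}` Riemann weights produce King's `(L^jη)^{2−d}`), `prod3_rate_king`: the two combined —
  `|s^{−4}·s^{2d}·(A′C′B′ − ACB)(x,y)| ≤ (θA + θC + θB)·K·V²·s^{2−d}·e^{−(κ/2)d(x,y)}` when the factor constants are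
  `a = K_A s^{2−d}`, `c = K_C s^{2−d}`, `b = K_B s^{2−d}`, `K = K_A K_C K_B`.
* §4 a `2 × 2`-free numerical example closing the pipeline on explicit data.

HONEST SCOPE: a kernel reproduction of the (4.42)–(4.43) ASSEMBLY only; the factor rates (Prop. 3.8, Lemma 4.5) and
the uniform decay (Thm 3.3 = [Ba 4]) are HYPOTHESES here, exactly as they are inputs on p. 675 (Lemma 4.5's own
mechanism is `King1986/CovarianceRate`; Prop. 3.8's averaging-weight factor is `King1986/AveragingWeightRate`).
Nothing here asserts anything about Bałaban's papers B4–B16; no `def … : Prop` hypothesis is introduced; value =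
completing the kernel census of King's printed `A = 0` η-rate layer (TEMPLATE §18), NOT summit progress (the cell's
T⁴ target is finite-volume rung (B)+1; nothing here bears on infinite volume, a mass gap, or the Clay problem).
-/

noncomputable section

open Matrix Finset Real

namespace Literature.MathematicalPhysics.QuantumFieldTheory.King1986

variable {n : Type*} [Fintype n]

/-! ## §1 The three replacement steps as one identity -/

/-- «We now replace … ; … Clearly we can replace … and … , and bound the error in the same way»: the difference of two
three-factor products is the sum of three products with exactly one factor replaced by a difference.
[cite: King1986, (4.42)–(4.43) p.675] [folklore] -/
theorem prod3_sub_prod3 (A A' C C' B B' : Matrix n n ℝ) :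
    A' * C' * B' - A * C * B = (A' - A) * C' * B' + A * (C' - C) * B' + A * C * (B' - B) := by
  noncomm_ring

/-! ## §2 (4.43) abstractly: the rate of a three-factor kernel from the rates of its factors -/

/-- **(4.43), abstract form.**  Kernels `A, A′, C, C′, B, B′`; uniform exponential decay at rate `κ` in a
pseudo-distance `d` is assumed for the four undifferenced factors `A, C, C′, B′` (constants `a, c, c, b`), the factor
DIFFERENCES `A′ − A, C′ − C, B′ − B` carry the same decay with constants `εA, εC, εB`, and the
lattice-sum constant `V` (`Σ_z e^{−(κ/2)d(x,z)} ≤ V`): the product difference decays at rate `κ/2` with constant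
`(εA·c·b + a·εC·b + a·c·εB)·V²`.  Three applications of `triple_decay_bound` to the identity `prod3_sub_prod3`.
[cite: King1986, (4.42)–(4.43) p.675] [folklore] -/
theorem prod3_rate (d : n → n → ℝ) (hd_nonneg : ∀ i j, 0 ≤ d i j)
    (hd_tri : ∀ i j k, d i k ≤ d i j + d j k)
    (A A' C C' B B' : Matrix n n ℝ) {κ a c b εA εC εB V : ℝ} (hκ : 0 ≤ κ)
    (ha : 0 ≤ a) (hεA : 0 ≤ εA) (hc : 0 ≤ c) (hεC : 0 ≤ εC)
    (hA : ∀ x z, |A x z| ≤ a * Real.exp (-(κ * d x z)))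
    (hC : ∀ z w, |C z w| ≤ c * Real.exp (-(κ * d z w)))
    (hC' : ∀ z w, |C' z w| ≤ c * Real.exp (-(κ * d z w)))
    (hB' : ∀ w y, |B' w y| ≤ b * Real.exp (-(κ * d w y)))
    (hdA : ∀ x z, |(A' - A) x z| ≤ εA * Real.exp (-(κ * d x z)))
    (hdC : ∀ z w, |(C' - C) z w| ≤ εC * Real.exp (-(κ * d z w)))
    (hdB : ∀ w y, |(B' - B) w y| ≤ εB * Real.exp (-(κ * d w y)))
    (hV : ∀ x, ∑ z, Real.exp (-(κ / 2 * d x z)) ≤ V) (x y : n) :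
    |(A' * C' * B' - A * C * B) x y|
      ≤ (εA * c * b + a * εC * b + a * c * εB) * V ^ 2 * Real.exp (-(κ / 2 * d x y)) := by
  have h1 := triple_decay_bound d hd_nonneg hd_tri (A' - A) C' B' hκ hεA hc hdA hC' hB' hV x y
  have h2 := triple_decay_bound d hd_nonneg hd_tri A (C' - C) B' hκ ha hεC hA hdC hB' hV x y
  have h3 := triple_decay_bound d hd_nonneg hd_tri A C (B' - B) hκ ha hc hA hC hdB hV x y
  rw [prod3_sub_prod3, Matrix.add_apply, Matrix.add_apply]
  calc |((A' - A) * C' * B') x y + (A * (C' - C) * B') x y + (A * C * (B' - B)) x y|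
      ≤ |((A' - A) * C' * B') x y + (A * (C' - C) * B') x y| + |(A * C * (B' - B)) x y| := abs_add_le _ _
    _ ≤ |((A' - A) * C' * B') x y| + |(A * (C' - C) * B') x y| + |(A * C * (B' - B)) x y| := by
        gcongr
        exact abs_add_le _ _
    _ ≤ εA * c * b * V ^ 2 * Real.exp (-(κ / 2 * d x y)) + a * εC * b * V ^ 2 * Real.exp (-(κ / 2 * d x y))
          + a * c * εB * V ^ 2 * Real.exp (-(κ / 2 * d x y)) := by
        gcongr
    _ = (εA * c * b + a * εC * b + a * c * εB) * V ^ 2 * Real.exp (-(κ / 2 * d x y)) := by ring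

/-! ## §3 King's relative form and the scale bookkeeping of (4.43) -/

/-- **Relative form.**  With factor rates written as King prints them — the replacement error of a factor is its own size
times a small number (`εA = θA·a` from Prop. 3.8's `CL^{−γk}`, `εC = θC·c` from Lemma 4.5's `CL^{−k}`, `εB = θB·b`) — the
product difference is `(θA + θC + θB)·(a·c·b)·V²·e^{−(κ/2)d}`. [cite: King1986, (4.43) p.675] [folklore] -/
theorem prod3_rate_rel (d : n → n → ℝ) (hd_nonneg : ∀ i j, 0 ≤ d i j)
    (hd_tri : ∀ i j k, d i k ≤ d i j + d j k)
    (A A' C C' B B' : Matrix n n ℝ) {κ a c b θA θC θB V : ℝ} (hκ : 0 ≤ κ)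
    (ha : 0 ≤ a) (hc : 0 ≤ c) (hθA : 0 ≤ θA) (hθC : 0 ≤ θC)
    (hA : ∀ x z, |A x z| ≤ a * Real.exp (-(κ * d x z)))
    (hC : ∀ z w, |C z w| ≤ c * Real.exp (-(κ * d z w)))
    (hC' : ∀ z w, |C' z w| ≤ c * Real.exp (-(κ * d z w)))
    (hB' : ∀ w y, |B' w y| ≤ b * Real.exp (-(κ * d w y)))
    (hdA : ∀ x z, |(A' - A) x z| ≤ θA * a * Real.exp (-(κ * d x z)))
    (hdC : ∀ z w, |(C' - C) z w| ≤ θC * c * Real.exp (-(κ * d z w)))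
    (hdB : ∀ w y, |(B' - B) w y| ≤ θB * b * Real.exp (-(κ * d w y)))
    (hV : ∀ x, ∑ z, Real.exp (-(κ / 2 * d x z)) ≤ V) (x y : n) :
    |(A' * C' * B' - A * C * B) x y|
      ≤ (θA + θC + θB) * (a * c * b) * V ^ 2 * Real.exp (-(κ / 2 * d x y)) := by
  have h := prod3_rate d hd_nonneg hd_tri A A' C C' B B' hκ ha (mul_nonneg hθA ha) hc (mul_nonneg hθC hc)
    hA hC hC' hB' hdA hdC hdB hV x y
  calc |(A' * C' * B' - A * C * B) x y|
      ≤ (θA * a * c * b + a * (θC * c) * b + a * c * (θB * b)) * V ^ 2 * Real.exp (-(κ / 2 * d x y)) := h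
    _ = (θA + θC + θB) * (a * c * b) * V ^ 2 * Real.exp (-(κ / 2 * d x y)) := by ring

/-- **Scale bookkeeping of (4.43).**  The prefactor `(L^jη)^{−4}` of (4.42), the Riemann weights `(L^jη)^{2d}` of the
double lattice sum, and three factors of size `(L^jη)^{2−d}` combine to King's `(L^jη)^{2−d}`:
`s^{−4}·s^{2d}·(s^{2−d})³ = s^{2−d}` for `s > 0` (real exponents, any `d`). [cite: King1986, (4.43) p.675] [folklore] -/
theorem scale_bookkeeping {s : ℝ} (hs : 0 < s) (d : ℝ) :
    s ^ (-4 : ℝ) * s ^ (2 * d) * (s ^ (2 - d)) ^ (3 : ℕ) = s ^ (2 - d) := by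
  have h3 : (s ^ (2 - d)) ^ (3 : ℕ) = s ^ (3 * (2 - d)) := by
    rw [← Real.rpow_natCast, ← Real.rpow_mul hs.le]
    norm_num [mul_comm]
  rw [h3, ← Real.rpow_add hs, ← Real.rpow_add hs]
  congr 1
  ring

/-- **(4.43) in King's bookkeeping.**  Factors of size `K_A s^{2−d}`, `K_C s^{2−d}`, `K_B s^{2−d}` at scale `s = L^jη`
with relative rates `θA, θC, θB`, the prefactor `s^{−4}·s^{2d}` of (4.42): the single-scale piece's two-spacing
difference is `≤ (θA + θC + θB)·(K_A K_C K_B)·V²·s^{2−d}·e^{−(κ/2)d(x,y)}` — the shape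
«C(L^jη)^{2−d}L^{−γj}exp[−δ₀(L^jη)^{−1}|x′ − y′|]» of (4.43) with `θA + θC + θB` in place of `L^{−γj}` and half the
decay rate. [cite: King1986, (4.42)–(4.43) p.675] [folklore] -/
theorem prod3_rate_king (dist : n → n → ℝ) (hd_nonneg : ∀ i j, 0 ≤ dist i j)
    (hd_tri : ∀ i j k, dist i k ≤ dist i j + dist j k)
    (A A' C C' B B' : Matrix n n ℝ) {κ s d KA KC KB θA θC θB V : ℝ} (hκ : 0 ≤ κ) (hs : 0 < s)
    (hKA : 0 ≤ KA) (hKC : 0 ≤ KC) (hθA : 0 ≤ θA) (hθC : 0 ≤ θC)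
    (hA : ∀ x z, |A x z| ≤ KA * s ^ (2 - d) * Real.exp (-(κ * dist x z)))
    (hC : ∀ z w, |C z w| ≤ KC * s ^ (2 - d) * Real.exp (-(κ * dist z w)))
    (hC' : ∀ z w, |C' z w| ≤ KC * s ^ (2 - d) * Real.exp (-(κ * dist z w)))
    (hB' : ∀ w y, |B' w y| ≤ KB * s ^ (2 - d) * Real.exp (-(κ * dist w y)))
    (hdA : ∀ x z, |(A' - A) x z| ≤ θA * (KA * s ^ (2 - d)) * Real.exp (-(κ * dist x z)))
    (hdC : ∀ z w, |(C' - C) z w| ≤ θC * (KC * s ^ (2 - d)) * Real.exp (-(κ * dist z w)))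
    (hdB : ∀ w y, |(B' - B) w y| ≤ θB * (KB * s ^ (2 - d)) * Real.exp (-(κ * dist w y)))
    (hV : ∀ x, ∑ z, Real.exp (-(κ / 2 * dist x z)) ≤ V) (x y : n) :
    |s ^ (-4 : ℝ) * s ^ (2 * d) * (A' * C' * B' - A * C * B) x y|
      ≤ (θA + θC + θB) * (KA * KC * KB) * V ^ 2 * s ^ (2 - d) * Real.exp (-(κ / 2 * dist x y)) := by
  have hsd : 0 ≤ s ^ (2 - d) := Real.rpow_nonneg hs.le _
  have h := prod3_rate_rel dist hd_nonneg hd_tri A A' C C' B B' hκ (mul_nonneg hKA hsd) (mul_nonneg hKC hsd)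
    hθA hθC hA hC hC' hB' hdA hdC hdB hV x y
  have hpref : 0 ≤ s ^ (-4 : ℝ) * s ^ (2 * d) := mul_nonneg (Real.rpow_nonneg hs.le _) (Real.rpow_nonneg hs.le _)
  rw [abs_mul, abs_of_nonneg hpref]
  calc s ^ (-4 : ℝ) * s ^ (2 * d) * |(A' * C' * B' - A * C * B) x y|
      ≤ s ^ (-4 : ℝ) * s ^ (2 * d)
          * ((θA + θC + θB) * (KA * s ^ (2 - d) * (KC * s ^ (2 - d)) * (KB * s ^ (2 - d))) * V ^ 2
              * Real.exp (-(κ / 2 * dist x y))) := mul_le_mul_of_nonneg_left h hpref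
    _ = (θA + θC + θB) * (KA * KC * KB) * V ^ 2 * (s ^ (-4 : ℝ) * s ^ (2 * d) * (s ^ (2 - d)) ^ (3 : ℕ))
          * Real.exp (-(κ / 2 * dist x y)) := by ring
    _ = (θA + θC + θB) * (KA * KC * KB) * V ^ 2 * s ^ (2 - d) * Real.exp (-(κ / 2 * dist x y)) := by
        rw [scale_bookkeeping hs d]

/-! ## §4 Example: the pipeline closes on explicit data -/

/-- One-point index set, all kernels constant: `A = C = B = 1`, `A′ = C′ = B′ = 1 + t`; then
`A′C′B′ − ACB = (1+t)³ − 1 = 3t + 3t² + t³`, and `prod3_sub_prod3` reads `t(1+t)² + t(1+t) + t`. -/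
example (t : ℝ) : (1 + t) ^ 3 - 1 = t * (1 + t) ^ 2 + 1 * t * (1 + t) + 1 * 1 * t := by ring

/-- `scale_bookkeeping` at `d = 4`, `s = 2`: `2^{−4}·2^{8}·(2^{−2})³ = 2^{−2}`. -/
example : (2 : ℝ) ^ (-4 : ℝ) * (2 : ℝ) ^ (2 * (4 : ℝ)) * ((2 : ℝ) ^ ((2 : ℝ) - 4)) ^ (3 : ℕ) = (2 : ℝ) ^ ((2 : ℝ) - 4) :=
  scale_bookkeeping (by norm_num) 4

end Literature.MathematicalPhysics.QuantumFieldTheory.King1986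

end
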